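import Literature.AnabelianGeometry.EtaleTheta.Discharge.Sec5OfBiKummerDataKummer
import Literature.AnabelianGeometry.EtaleTheta.Discharge.Sec5OfConnectedTemperoid

/-!
# [EtTh] §5 p.331 / Prop. 5.2 (iii) p.324 (PDF pp.105, 98): the rows `StrvSection` (F-0555) and `ThetaPairKummerClass` (F-0558) at the GENUINE §5 data

Mochizuki, *The étale theta function and its Frobenioid-theoretic manifestations*, Publ. RIMS **45** (2009)
[cite: MochizukiEtTh2009, Prop 5.2 (iii) p.324 (PDF p.98); §5 p.331 (PDF p.105)].  abc-iut cell, block F (fact-proving wave,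
batch 2), seat abc-iut-f-126, tranche 126 = FACT-LIST rows **F-0555** `ThetaFrobenioid.StrvSection`, **F-0556**
`FrobenioidThetaBiKummer.ThetaPairActionsAgree`, **F-0558** `FrobenioidThetaBiKummer.ThetaPairKummerClass` (trunk
`FrobenioidThetaBiKummer.lean`).  PROOF-ONLY: no `def`, no `Prop` fact, no instance, nothing landed is edited or restated; imports
abc-iut-L2-t4's `Discharge/Sec5OfBiKummerDataKummer.lean` and `Discharge/Sec5OfConnectedTemperoid.lean` (tranche-125 twin:
abc-iut-f-125's `Discharge/Sec5SgpUniqueOfBiKummerData.lean`; same binder conventions).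

The three rows are `parametrised` predicates on the DATA-ONLY interface `ThetaFrobenioid`; universal closures REFUTED and toy
instances PROVED by abc-iut-w6-d043 (`Discharge/Sec5BiKummerSchemaVerdicts.lean`); ABSTRACT instance forms at the printed hypotheses
in this seat's `Discharge/Sec5Prop52InstanceForms.lean` (p432149; cited, not imported — its olean was not built at filing time, so the
two one-line arguments used from it are re-run inline, nothing is re-declared).  HERE: the rows AT THE NAMED GENUINE INSTANCES the
cell's §5 constructions provide (FACT-LIST rule R5): abc-iut-L2-t4's `ThetaFrobenioid.ofRootData` (sections DEFINED as the unique lifts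
of p.331), `ThetaFrobenioid.ofBiKummerData` (the §5 data ASSEMBLED from abc-iut-L2-t3's §4 bi-Kummer setting over the model
Frobenioid; the instance the kernel DAG index cites) and `ThetaFrobenioid.ofConnectedTemperoidData` (the same over the GENUINE connected
base `B^temp(Π^tp_X)⁰`, `s^trv_N` CONSTRUCTED).

* **F-0555** — `StrvSection` there is abc-iut-L2-t4's `strvSection_ofRootData` / `_ofBiKummerData` (input `hσ`, [FrdI] Prop. 5.6) /
  `_ofConnectedTemperoidData` (UNCONDITIONAL), cited not restated; NEW consequence "`A_N` is Aut-ample" ([FrdI] Def. 1.2 (iv)) for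
  each: `isAutAmple_AN_ofRootData`, `isAutAmple_AN_ofBiKummerData`, `isAutAmple_AN_ofConnectedTemperoidData` (the companion of
  abc-iut-L2-t4's `autAmpleBN_…`, "`B_N` is Aut-ample", p.330).
* **F-0558, `η`-existential form** — `exists_thetaPairKummerClass_ofBiKummerData`: for the assembled data and EVERY comparison
  `ν : (l·Δ_Θ)_{B_N} ⊗ ℤ/Nℤ ⥲ μ_N(B_N)`, SOME cocycle `η` on `H_{B_N}` satisfies Prop. 5.2 (iii) (cocycle form, witness `u := 1`,
  `η := ν⁻¹ ∘ (s^⊓-gp_N · (s^⊔-gp_N)⁻¹)`) — from abc-iut-L2-t4's THEOREM `biKummerDifferenceMem_ofBiKummerData` (Prop. 4.3 (iii) at the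
  data; inputs `hσ`, `hH`, `hfrac`, `haut` as there); this is the `←` half of this seat's `exists_thetaPairKummerClass_iff`
  (`(∃ η, 5.2 (iii)) ⟺ 4.3 (iii)`) run at the data.  `exists_thetaPairKummerClass_of_facts`: the same for ANY §5 datum carrying
  abc-iut-L2-t4's bundle `Facts` — in particular for `ofConnectedTemperoidData` through `facts_ofConnectedTemperoidData`
  (`exists_thetaPairKummerClass_ofConnectedTemperoidData`).  The PINNED `η` (reduction mod `N` of `η̲̈^Θ`) is the business of
  `Discharge/Sec5ThetaSectionCompatOfKummerClass.lean` (`hKR_ofBiKummerData_of_pin`), not claimed here.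
* **F-0556** at the genuine data is abc-iut-w6-d086's `thetaPairActionsAgree_ofBiKummerData_iff` /
  `thetaPairActionsAgree_ofConnectedTemperoidData_iff` (`Discharge/Sec5Prop52iiOfConnectedTemperoid.lean`, built on this seat's
  `thetaPairActionsAgree_iff_definingRelations`) — cited, not restated.
* `prop52Rows_ofBiKummerData` / `prop52Rows_ofConnectedTemperoidData` — the **tranche-126 certificates** at the genuine data:
  `StrvSection ∧ (∀ ν, ∃ η, ThetaPairKummerClass η ν)`.

HONEST FRAMING: kernel-checked consequences for data so constructed, under the printed [FrdI]/§1–§4 inputs listed as hypotheses;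
nothing of [EtTh] (a refereed paper) is asserted unconditionally; a FACT row is an assumption label, not an endorsement; nothing here
bears on [IUTchIII] Cor. 3.12; no side is taken; typed ≠ proved.
-/

noncomputable section

namespace Literature.AnabelianGeometry.EtaleTheta

open CategoryTheory Opposite Literature.AlgebraicGeometry.Frobenioids Literature.AnabelianGeometry.SemiGraphs
  Literature.AnabelianGeometry.SemiGraphs.GaloisObjects Literature.AlgebraicGeometry.Frobenioids.QuasiTemperoid.BTempConnected

universe u₀ v₀ u v w w' v' u' u''

namespace ThetaFrobenioid

/-! ### Any §5 datum carrying the bundle `Facts` -/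

section Generic

variable {C : Type u'} [Category.{v'} C] {D : Type u''} [Category.{w'} D] {𝔉 : ThetaFrobenioid.{w} C D}

/-- **F-0558, `η`-existential form, from F-0551**: if the bi-Kummer difference is `μ_N(B_N)`-valued (Prop. 4.3 (iii),
`BiKummerDifferenceMem`), then for EVERY comparison `ν` the tautological cocycle `η := ν⁻¹ ∘ (s^⊓-gp_N · (s^⊔-gp_N)⁻¹)` satisfies
Prop. 5.2 (iii) in cocycle form with `u := 1` (the `←` half of this seat's `exists_thetaPairKummerClass_iff`, p432149, re-run here).
[cite: MochizukiEtTh2009, Prop 5.2 (iii) p.324 (PDF p.98); Prop 4.3 (iii) p.317 (PDF p.91)] -/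
theorem exists_thetaPairKummerClass_of_biKummerDifferenceMem (hd : 𝔉.BiKummerDifferenceMem)
    (ν : 𝔉.lDeltaModN 𝔉.BN ≃* 𝔉.muTorsion 𝔉.BN 𝔉.N) :
    ∃ η : 𝔉.HB → 𝔉.lDeltaModN 𝔉.BN, FrobenioidThetaBiKummer.ThetaPairKummerClass 𝔉 η ν := by
  refine ⟨fun h => ν.symm ⟨𝔉.sgpCap (h : Aut (𝔉.base.obj 𝔉.BN)) * (𝔉.sgpCup h)⁻¹,
    (𝔉.biKummerDifferenceMem_iff.mp hd) h⟩, 1, one_mem _, fun x => ?_⟩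
  have hx : 𝔉.sgpCap (x : Aut (𝔉.base.obj 𝔉.BN)) * (𝔉.sgpCup x)⁻¹ =
      (ν (ν.symm ⟨𝔉.sgpCap (x : Aut (𝔉.base.obj 𝔉.BN)) * (𝔉.sgpCup x)⁻¹,
        (𝔉.biKummerDifferenceMem_iff.mp hd) x⟩) : Aut 𝔉.BN) := by
    rw [MulEquiv.apply_symm_apply]
  rw [← hx, mul_one, inv_one, mul_one, mul_inv_cancel, one_mul]

/-- **F-0558, `η`-existential form, for any §5 datum carrying abc-iut-L2-t4's bundle `Facts`** (whose field
`biKummerDifferenceMem` is Prop. 4.3 (iii)).  [cite: MochizukiEtTh2009, Prop 5.2 (iii) p.324 (PDF p.98)] -/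
theorem exists_thetaPairKummerClass_of_facts (H : 𝔉.Facts) (ν : 𝔉.lDeltaModN 𝔉.BN ≃* 𝔉.muTorsion 𝔉.BN 𝔉.N) :
    ∃ η : 𝔉.HB → 𝔉.lDeltaModN 𝔉.BN, FrobenioidThetaBiKummer.ThetaPairKummerClass 𝔉 η ν :=
  exists_thetaPairKummerClass_of_biKummerDifferenceMem H.biKummerDifferenceMem ν

end Generic

/-! ### At `ofRootData` -/

section RootData

variable {C : Type u'} [Category.{v'} C] {D : Type u''} [Category.{w'} D]
  (F : FrobenioidTheta.TemperedFrobenioidStub.{w} C D) (Q : FrobenioidTheta.ThetaSubquotientStub.{w} D)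
  (l : ℕ) (odd_l : Odd l) (N : ℕ+) (T : ThetaEnvData.{v'} N) (Acirc AN BN : C) (sCap sCup : AN ⟶ BN)
  (base_map_sCap : F.pre.base.map sCap = F.pre.base.map sCup)
  (isPreStep_sCap : F.pre.IsPreStep sCap) (isPreStep_sCup : F.pre.IsPreStep sCup)
  (ρ : T.PiX →* Aut (F.pre.base.obj BN)) (ρ_surjective : Function.Surjective ρ)
  (isOpen_ker_ρ : IsOpen (ρ.ker : Set T.PiX)) (σ : Aut (F.pre.base.obj AN) →* Aut AN)
  (K : Type w) [Field K] (constEmb : Kˣ →* F.biratUnits BN) (constEmb_injective : Function.Injective constEmb)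
  (thetaFn : F.biratUnits Acirc)
  (hepi : ∀ ⦃X Y : C⦄ (f : X ⟶ Y), Epi f) (hiso : F.pre.IsOfIsotropicType)
  (hiiid : ∀ ⦃A B B' : C⦄ (φ : A ⟶ B) (φ' : A ⟶ B'), F.pre.IsCoAngularPreStep φ →
    F.pre.IsCoAngularPreStep φ' → F.pre.div φ ∣ F.pre.div φ' →
      ∃ f : B ⟶ B', F.pre.IsCoAngularPreStep f ∧ φ ≫ f = φ')
  (hdivc : ∀ g : Aut (F.pre.base.obj BN),
    F.pre.div ((σ ((ofRootData.aux F Q l odd_l N T Acirc AN BN sCap sCup base_map_sCap isPreStep_sCap isPreStep_sCup ρ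
      ρ_surjective isOpen_ker_ρ σ K constEmb constEmb_injective thetaFn).autBaseIsoAB.symm g)).hom ≫ sCap) = F.pre.div sCap)
  (hdivp : ∀ h : (ofRootData.aux F Q l odd_l N T Acirc AN BN sCap sCup base_map_sCap isPreStep_sCap isPreStep_sCup ρ
      ρ_surjective isOpen_ker_ρ σ K constEmb constEmb_injective thetaFn).HB,
    F.pre.div ((σ ((ofRootData.aux F Q l odd_l N T Acirc AN BN sCap sCup base_map_sCap isPreStep_sCap isPreStep_sCup ρ
      ρ_surjective isOpen_ker_ρ σ K constEmb constEmb_injective thetaFn).autBaseIsoAB.symm h.1)).hom ≫ sCup) =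
      F.pre.div sCup)

/-- **F-0555 consequence at `ofRootData`**: "`A_N` is Aut-ample" ([FrdI] Def. 1.2 (iv): every automorphism of `A_N^bs` lifts, namely to
`s^trv_N` of it) for the §5 data, from the section property of the base-Frobenius pair `σ` (input `hσ`, [FrdI] Prop. 5.6; abc-iut-L2-t4's
`strvSection_ofRootData`).  [cite: MochizukiEtTh2009, §5 p.330–331 (PDF pp.104–105)] -/
theorem isAutAmple_AN_ofRootData (hσ : ∀ g : Aut (F.pre.base.obj AN), F.pre.base.mapAut AN (σ g) = g) :
    (ofRootData F Q l odd_l N T Acirc AN BN sCap sCup base_map_sCap isPreStep_sCap isPreStep_sCup ρ ρ_surjective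
        isOpen_ker_ρ σ K constEmb constEmb_injective thetaFn hepi hiso hiiid hdivc hdivp).IsAutAmple
      (ofRootData F Q l odd_l N T Acirc AN BN sCap sCup base_map_sCap isPreStep_sCap isPreStep_sCup ρ ρ_surjective
        isOpen_ker_ρ σ K constEmb constEmb_injective thetaFn hepi hiso hiiid hdivc hdivp).AN :=
  fun β => ⟨_, strvSection_ofRootData F Q l odd_l N T Acirc AN BN sCap sCup base_map_sCap isPreStep_sCap isPreStep_sCup ρ
    ρ_surjective isOpen_ker_ρ σ K constEmb constEmb_injective thetaFn hepi hiso hiiid hdivc hdivp hσ β⟩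

end RootData

/-! ### At the assembled data `ofBiKummerData` (any bi-Kummer setting) -/

section BiKummerData

variable {K : Type u₀} [Field K] {X : SemiGraphs.TemperedArithmeticGroup.{u₀} K} {D₀ : Type u₀} [Category.{v₀} D₀]
  {V : FrdIMonoidStub.{w}} {T₀ : RealifiedDivisorMonoids (D₀ := D₀) V} {D : Type u} [Category.{v} D]
  {VD : FrdICatStub.{u, v, w} D} {S : BiKummerSetting X T₀ D VD}
  {pullFrac : ∀ {A A' : S.C} (_ : A' ⟶ A), S.biratUnits A → S.biratUnits A'}
  {lv N : ℕ+} {T : ThetaEnvData.{max v w} N} {θ : S.biratUnits S.Aodot} {Bl : S.C}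
  {Pl : S.FractionPair θ Bl} {Rl : S.NthRoot θ Pl lv pullFrac}
  (h : ModelFrobenioid.Hypotheses S.tf.divisorMonoid S.tf.ratFnFunctor)
  (toB : ∀ A : S.C, S.biratUnits A →* S.tf.biratUnitsModel A) (Q : FrobenioidTheta.ThetaSubquotientStub.{w} D)
  (odd_l : Odd (lv : ℕ)) (R : S.NthRoot Rl.root Rl.pair N pullFrac) (ιX : T.PiX ≃ₜ* X.Pi)
  (hopen : IsOpen ((S.galoisSurj R.AN.base R.αData.isGalois).ker : Set X.Pi)) (σ : Aut R.AN.base →* Aut R.AN)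
  (K' : Type w) [Field K'] (constEmb : K'ˣ →* S.tf.biratUnitsModel R.BN)
  (constEmb_injective : Function.Injective constEmb)
  (hdivc : ∀ g : Aut R.BN.base,
    ModelFrobenioid.div ((σ ((BiKummerSetting.NthRoot.baseIso S R).conjAut.symm g)).hom ≫ R.pair.num) =
      ModelFrobenioid.div R.pair.num)
  (hdivp : ∀ y : T.PiYdd,
    ModelFrobenioid.div ((σ (S.galoisSurj R.AN.base R.αData.isGalois (ιX y.1))).hom ≫ R.pair.den) =
      ModelFrobenioid.div R.pair.den)

/-- **F-0555 consequence at `ofBiKummerData`**: "`A_N` is Aut-ample" ([FrdI] Def. 1.2 (iv)) for the assembled §5 data, from the section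
property of `σ` (input `hσ`, [FrdI] Prop. 5.6; abc-iut-L2-t4's `strvSection_ofBiKummerData`).
[cite: MochizukiEtTh2009, §5 p.330–331 (PDF pp.104–105)] -/
theorem isAutAmple_AN_ofBiKummerData (hσ : ∀ g : Aut R.AN.base, ModelFrobenioid.baseMap (σ g).hom = g.hom) :
    (ofBiKummerData h toB Q odd_l R ιX hopen σ K' constEmb constEmb_injective hdivc hdivp).IsAutAmple
      (ofBiKummerData h toB Q odd_l R ιX hopen σ K' constEmb constEmb_injective hdivc hdivp).AN :=
  fun β => ⟨_, strvSection_ofBiKummerData h toB Q odd_l R ιX hopen σ K' constEmb constEmb_injective hdivc hdivp hσ β⟩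

/-- **F-0558 at `ofBiKummerData`, `η`-existential form**: for the assembled §5 data and EVERY comparison
`ν : (l·Δ_Θ)_{B_N} ⊗ ℤ/Nℤ ⥲ μ_N(B_N)`, SOME cocycle `η` on `H_{B_N}` satisfies Prop. 5.2 (iii) (cocycle form) — because the bi-Kummer
difference is `μ_N(B_N)`-valued there (abc-iut-L2-t4's THEOREM `biKummerDifferenceMem_ofBiKummerData`, Prop. 4.3 (iii); inputs as there:
`hσ` [FrdI] Prop. 5.6, `hH` `Π^tp_Ÿ ⊆ H_⊙` p.322 (PDF p.96), `hfrac`/`haut` the [FrdI] Thm. 5.2 (ii) dictionary laws of `toB`).  The PINNED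
`η` is `Sec5ThetaSectionCompatOfKummerClass.lean`'s business.  [cite: MochizukiEtTh2009, Prop 5.2 (iii) p.324 (PDF p.98); Prop 4.3 (iii) p.317 (PDF p.91)] -/
theorem exists_thetaPairKummerClass_ofBiKummerData
    (hσ : ∀ g : Aut R.AN.base, ModelFrobenioid.baseMap (σ g).hom = g.hom)
    (hH : ∀ y : T.PiX, y ∈ T.PiYdd → ιX y ∈ S.Hodot)
    (hfrac : ∀ {A B : S.C} (s' s'' : A ⟶ B) (h' : S.IsPreStep s') (h'' : S.IsPreStep s'')
      (hb : PreFrobenioid.BaseEquivalent S.F s' s''),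
      (toB A (S.fracOf s' s'' h' h'' hb) : S.tf.ratFnFunctor.obj (op A.base)) *
        ModelFrobenioid.unit s'' = ModelFrobenioid.unit s')
    (haut : ∀ {A : S.C} (e : Aut A) (x : S.biratUnits A),
      (toB A (S.biratAut A e x) : S.tf.ratFnFunctor.obj (op A.base)) =
        pull S.tf.ratFnFunctor (ModelFrobenioid.baseMap e.inv) (toB A x : S.tf.ratFnFunctor.obj (op A.base)))
    (ν : (ofBiKummerData h toB Q odd_l R ιX hopen σ K' constEmb constEmb_injective hdivc hdivp).lDeltaModN
        (ofBiKummerData h toB Q odd_l R ιX hopen σ K' constEmb constEmb_injective hdivc hdivp).BN ≃*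
      (ofBiKummerData h toB Q odd_l R ιX hopen σ K' constEmb constEmb_injective hdivc hdivp).muTorsion
        (ofBiKummerData h toB Q odd_l R ιX hopen σ K' constEmb constEmb_injective hdivc hdivp).BN
        (ofBiKummerData h toB Q odd_l R ιX hopen σ K' constEmb constEmb_injective hdivc hdivp).N) :
    ∃ η : (ofBiKummerData h toB Q odd_l R ιX hopen σ K' constEmb constEmb_injective hdivc hdivp).HB →
        (ofBiKummerData h toB Q odd_l R ιX hopen σ K' constEmb constEmb_injective hdivc hdivp).lDeltaModN
          (ofBiKummerData h toB Q odd_l R ιX hopen σ K' constEmb constEmb_injective hdivc hdivp).BN,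
      FrobenioidThetaBiKummer.ThetaPairKummerClass
        (ofBiKummerData h toB Q odd_l R ιX hopen σ K' constEmb constEmb_injective hdivc hdivp) η ν :=
  exists_thetaPairKummerClass_of_biKummerDifferenceMem
    (biKummerDifferenceMem_ofBiKummerData h toB Q odd_l R ιX hopen σ K' constEmb constEmb_injective hdivc hdivp hσ hH
      hfrac haut) ν

/-- **Tranche-126 certificate at the assembled §5 data `ofBiKummerData`**: F-0555 `StrvSection` HOLDS (abc-iut-L2-t4's theorem) and
F-0558 `ThetaPairKummerClass` is satisfied by SOME cocycle for every comparison `ν`; F-0556 at this data (⟺ the printed defining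
relations) is abc-iut-w6-d086's `thetaPairActionsAgree_ofBiKummerData_iff`.  Inputs: those of `biKummerDifferenceMem_ofBiKummerData` only.
[cite: MochizukiEtTh2009, Prop 5.2 p.324 (PDF p.98); §5 p.331 (PDF p.105)] -/
theorem prop52Rows_ofBiKummerData
    (hσ : ∀ g : Aut R.AN.base, ModelFrobenioid.baseMap (σ g).hom = g.hom)
    (hH : ∀ y : T.PiX, y ∈ T.PiYdd → ιX y ∈ S.Hodot)
    (hfrac : ∀ {A B : S.C} (s' s'' : A ⟶ B) (h' : S.IsPreStep s') (h'' : S.IsPreStep s'')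
      (hb : PreFrobenioid.BaseEquivalent S.F s' s''),
      (toB A (S.fracOf s' s'' h' h'' hb) : S.tf.ratFnFunctor.obj (op A.base)) *
        ModelFrobenioid.unit s'' = ModelFrobenioid.unit s')
    (haut : ∀ {A : S.C} (e : Aut A) (x : S.biratUnits A),
      (toB A (S.biratAut A e x) : S.tf.ratFnFunctor.obj (op A.base)) =
        pull S.tf.ratFnFunctor (ModelFrobenioid.baseMap e.inv) (toB A x : S.tf.ratFnFunctor.obj (op A.base))) :
    (ofBiKummerData h toB Q odd_l R ιX hopen σ K' constEmb constEmb_injective hdivc hdivp).StrvSection ∧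
    ∀ ν : (ofBiKummerData h toB Q odd_l R ιX hopen σ K' constEmb constEmb_injective hdivc hdivp).lDeltaModN
          (ofBiKummerData h toB Q odd_l R ιX hopen σ K' constEmb constEmb_injective hdivc hdivp).BN ≃*
        (ofBiKummerData h toB Q odd_l R ιX hopen σ K' constEmb constEmb_injective hdivc hdivp).muTorsion
          (ofBiKummerData h toB Q odd_l R ιX hopen σ K' constEmb constEmb_injective hdivc hdivp).BN
          (ofBiKummerData h toB Q odd_l R ιX hopen σ K' constEmb constEmb_injective hdivc hdivp).N,
      ∃ η : (ofBiKummerData h toB Q odd_l R ιX hopen σ K' constEmb constEmb_injective hdivc hdivp).HB →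
          (ofBiKummerData h toB Q odd_l R ιX hopen σ K' constEmb constEmb_injective hdivc hdivp).lDeltaModN
            (ofBiKummerData h toB Q odd_l R ιX hopen σ K' constEmb constEmb_injective hdivc hdivp).BN,
        FrobenioidThetaBiKummer.ThetaPairKummerClass
          (ofBiKummerData h toB Q odd_l R ιX hopen σ K' constEmb constEmb_injective hdivc hdivp) η ν :=
  ⟨strvSection_ofBiKummerData h toB Q odd_l R ιX hopen σ K' constEmb constEmb_injective hdivc hdivp hσ,
    exists_thetaPairKummerClass_ofBiKummerData h toB Q odd_l R ιX hopen σ K' constEmb constEmb_injective hdivc hdivp hσ hH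
      hfrac haut⟩

end BiKummerData

/-! ### At the §5 data over the GENUINE connected base `B^temp(Π^tp_X)⁰` (`ofConnectedTemperoidData`) -/

section ConnectedTemperoid

variable {K : Type u₀} [Field K] {X : SemiGraphs.TemperedArithmeticGroup.{u₀} K} {D₀ : Type u₀} [Category.{v₀} D₀]
  {V : FrdIMonoidStub.{w}} {T₀ : RealifiedDivisorMonoids (D₀ := D₀) V}
  {VD : FrdICatStub.{u₀ + 1, u₀, w} (ConnectedPart (BTemp X.Pi))}
  {tf : TemperedFrobenioid T₀ (ConnectedPart (BTemp X.Pi)) VD} {hZ : tf.monoidType = MonoidType.Z}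
  {hP : ∀ A : (ConnectedPart (BTemp X.Pi))ᵒᵖ, IsPerfect (tf.Φ.carrier A)}
  {NH : Subgroup (Field.absoluteGaloisGroup K) → tf.category → ℕ+ → Prop} {A₀ : tf.category}
  {hA₀ : PreFrobenioid.IsFrobeniusTrivial tf.toElem A₀} {hA₀' : SemiGraphs.IsGaloisObj A₀.base.obj}
  {pullFrac : ∀ {A A' : (BiKummerSetting.mkOfConnectedTemperoid X tf hZ hP NH A₀ hA₀ hA₀').C} (_ : A' ⟶ A),
    (BiKummerSetting.mkOfConnectedTemperoid X tf hZ hP NH A₀ hA₀ hA₀').biratUnits A →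
      (BiKummerSetting.mkOfConnectedTemperoid X tf hZ hP NH A₀ hA₀ hA₀').biratUnits A'}
  {lv N : ℕ+} {T : ThetaEnvData.{max u₀ w} N}
  {θ : (BiKummerSetting.mkOfConnectedTemperoid X tf hZ hP NH A₀ hA₀ hA₀').biratUnits
    (BiKummerSetting.mkOfConnectedTemperoid X tf hZ hP NH A₀ hA₀ hA₀').Aodot}
  {Bl : (BiKummerSetting.mkOfConnectedTemperoid X tf hZ hP NH A₀ hA₀ hA₀').C}
  {Pl : (BiKummerSetting.mkOfConnectedTemperoid X tf hZ hP NH A₀ hA₀ hA₀').FractionPair θ Bl}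
  {Rl : (BiKummerSetting.mkOfConnectedTemperoid X tf hZ hP NH A₀ hA₀ hA₀').NthRoot θ Pl lv pullFrac}
  (h : ModelFrobenioid.Hypotheses tf.divisorMonoid tf.ratFnFunctor)
  (Q : FrobenioidTheta.ThetaSubquotientStub.{w} (ConnectedPart (BTemp X.Pi))) (odd_l : Odd (lv : ℕ))
  (R : (BiKummerSetting.mkOfConnectedTemperoid X tf hZ hP NH A₀ hA₀ hA₀').NthRoot Rl.root Rl.pair N pullFrac)
  (ιX : T.PiX ≃ₜ* X.Pi) (K' : Type w) [Field K'] (constEmb : K'ˣ →* tf.biratUnitsModel R.BN)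
  (constEmb_injective : Function.Injective constEmb)
  (hinvc : ∀ g : Aut R.AN.base,
    pull tf.divisorMonoid g.hom (ModelFrobenioid.div R.pair.num) = ModelFrobenioid.div R.pair.num)
  (hinvp : ∀ y : T.PiX, y ∈ T.PiYdd →
    pull tf.divisorMonoid ((BiKummerSetting.mkOfConnectedTemperoid X tf hZ hP NH A₀ hA₀ hA₀').galoisSurj R.AN.base
      R.αData.isGalois (ιX y)).hom (ModelFrobenioid.div R.pair.den) = ModelFrobenioid.div R.pair.den)

/-- **F-0555 consequence over `B^temp(Π^tp_X)⁰`, UNCONDITIONAL**: "`A_N` is Aut-ample" ([FrdI] Def. 1.2 (iv)) for the §5 data over the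
genuine connected base (`s^trv_N` constructed; abc-iut-L2-t4's `strvSection_ofConnectedTemperoidData`).
[cite: MochizukiEtTh2009, §5 p.330–331 (PDF pp.104–105)] -/
theorem isAutAmple_AN_ofConnectedTemperoidData :
    (ofConnectedTemperoidData h Q odd_l R ιX K' constEmb constEmb_injective hinvc hinvp).IsAutAmple
      (ofConnectedTemperoidData h Q odd_l R ιX K' constEmb constEmb_injective hinvc hinvp).AN :=
  fun β => ⟨_, strvSection_ofConnectedTemperoidData h Q odd_l R ιX K' constEmb constEmb_injective hinvc hinvp β⟩

/-- **F-0558 over `B^temp(Π^tp_X)⁰`, `η`-existential form**, for the §5 data over the genuine connected base carrying the bundle `Facts`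
(abc-iut-L2-t4's `facts_ofConnectedTemperoidData`: from `hH` `Π^tp_Ÿ ⊆ H_⊙`, `hconst` Def. 3.6 (iii), `hgc` Lemma 5.8's geometric
connectedness): for EVERY comparison `ν`, SOME cocycle satisfies Prop. 5.2 (iii) in cocycle form.
[cite: MochizukiEtTh2009, Prop 5.2 (iii) p.324 (PDF p.98); Prop 4.3 (iii) p.317 (PDF p.91)] -/
theorem exists_thetaPairKummerClass_ofConnectedTemperoidData
    (hH : ∀ y : T.PiX, y ∈ T.PiYdd → ιX y ∈ (BiKummerSetting.mkOfConnectedTemperoid X tf hZ hP NH A₀ hA₀ hA₀').Hodot)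
    (hconst : ∀ (e : Aut R.BN) (k : K'ˣ), tf.biratAutModel R.BN e (constEmb k) = constEmb k)
    (hgc : ∀ u : (ofConnectedTemperoidData h Q odd_l R ιX K' constEmb constEmb_injective hinvc hinvp).units
        (ofConnectedTemperoidData h Q odd_l R ιX K' constEmb constEmb_injective hinvc hinvp).BN,
      (∀ y ∈ (ofConnectedTemperoidData h Q odd_l R ιX K' constEmb constEmb_injective hinvc hinvp).imPiY,
        (ofConnectedTemperoidData h Q odd_l R ιX K' constEmb constEmb_injective hinvc hinvp).sgpCap y *
          (u : Aut (ofConnectedTemperoidData h Q odd_l R ιX K' constEmb constEmb_injective hinvc hinvp).BN) *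
          ((ofConnectedTemperoidData h Q odd_l R ιX K' constEmb constEmb_injective hinvc hinvp).sgpCap y)⁻¹ = u) →
      (ofConnectedTemperoidData h Q odd_l R ιX K' constEmb constEmb_injective hinvc hinvp).unitsToBirat
          (ofConnectedTemperoidData h Q odd_l R ιX K' constEmb constEmb_injective hinvc hinvp).BN u ∈
        (ofConnectedTemperoidData h Q odd_l R ιX K' constEmb constEmb_injective hinvc hinvp).constEmb.range)
    (ν : (ofConnectedTemperoidData h Q odd_l R ιX K' constEmb constEmb_injective hinvc hinvp).lDeltaModN
        (ofConnectedTemperoidData h Q odd_l R ιX K' constEmb constEmb_injective hinvc hinvp).BN ≃*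
      (ofConnectedTemperoidData h Q odd_l R ιX K' constEmb constEmb_injective hinvc hinvp).muTorsion
        (ofConnectedTemperoidData h Q odd_l R ιX K' constEmb constEmb_injective hinvc hinvp).BN
        (ofConnectedTemperoidData h Q odd_l R ιX K' constEmb constEmb_injective hinvc hinvp).N) :
    ∃ η : (ofConnectedTemperoidData h Q odd_l R ιX K' constEmb constEmb_injective hinvc hinvp).HB →
        (ofConnectedTemperoidData h Q odd_l R ιX K' constEmb constEmb_injective hinvc hinvp).lDeltaModN
          (ofConnectedTemperoidData h Q odd_l R ιX K' constEmb constEmb_injective hinvc hinvp).BN,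
      FrobenioidThetaBiKummer.ThetaPairKummerClass
        (ofConnectedTemperoidData h Q odd_l R ιX K' constEmb constEmb_injective hinvc hinvp) η ν :=
  exists_thetaPairKummerClass_of_facts
    (facts_ofConnectedTemperoidData h Q odd_l R ιX K' constEmb constEmb_injective hinvc hinvp hH hconst hgc) ν

/-- **Tranche-126 certificate over the GENUINE connected base `B^temp(Π^tp_X)⁰`**: F-0555 `StrvSection` HOLDS unconditionally
(abc-iut-L2-t4) and F-0558 `ThetaPairKummerClass` is satisfied by SOME cocycle for every comparison `ν` (inputs: those of
`facts_ofConnectedTemperoidData`); F-0556 there (⟺ defining relations) is abc-iut-w6-d086's `thetaPairActionsAgree_ofConnectedTemperoidData_iff`.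
[cite: MochizukiEtTh2009, Prop 5.2 p.324 (PDF p.98); §5 p.331 (PDF p.105)] -/
theorem prop52Rows_ofConnectedTemperoidData
    (hH : ∀ y : T.PiX, y ∈ T.PiYdd → ιX y ∈ (BiKummerSetting.mkOfConnectedTemperoid X tf hZ hP NH A₀ hA₀ hA₀').Hodot)
    (hconst : ∀ (e : Aut R.BN) (k : K'ˣ), tf.biratAutModel R.BN e (constEmb k) = constEmb k)
    (hgc : ∀ u : (ofConnectedTemperoidData h Q odd_l R ιX K' constEmb constEmb_injective hinvc hinvp).units
        (ofConnectedTemperoidData h Q odd_l R ιX K' constEmb constEmb_injective hinvc hinvp).BN,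
      (∀ y ∈ (ofConnectedTemperoidData h Q odd_l R ιX K' constEmb constEmb_injective hinvc hinvp).imPiY,
        (ofConnectedTemperoidData h Q odd_l R ιX K' constEmb constEmb_injective hinvc hinvp).sgpCap y *
          (u : Aut (ofConnectedTemperoidData h Q odd_l R ιX K' constEmb constEmb_injective hinvc hinvp).BN) *
          ((ofConnectedTemperoidData h Q odd_l R ιX K' constEmb constEmb_injective hinvc hinvp).sgpCap y)⁻¹ = u) →
      (ofConnectedTemperoidData h Q odd_l R ιX K' constEmb constEmb_injective hinvc hinvp).unitsToBirat
          (ofConnectedTemperoidData h Q odd_l R ιX K' constEmb constEmb_injective hinvc hinvp).BN u ∈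
        (ofConnectedTemperoidData h Q odd_l R ιX K' constEmb constEmb_injective hinvc hinvp).constEmb.range) :
    (ofConnectedTemperoidData h Q odd_l R ιX K' constEmb constEmb_injective hinvc hinvp).StrvSection ∧
    ∀ ν : (ofConnectedTemperoidData h Q odd_l R ιX K' constEmb constEmb_injective hinvc hinvp).lDeltaModN
          (ofConnectedTemperoidData h Q odd_l R ιX K' constEmb constEmb_injective hinvc hinvp).BN ≃*
        (ofConnectedTemperoidData h Q odd_l R ιX K' constEmb constEmb_injective hinvc hinvp).muTorsion
          (ofConnectedTemperoidData h Q odd_l R ιX K' constEmb constEmb_injective hinvc hinvp).BN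
          (ofConnectedTemperoidData h Q odd_l R ιX K' constEmb constEmb_injective hinvc hinvp).N,
      ∃ η : (ofConnectedTemperoidData h Q odd_l R ιX K' constEmb constEmb_injective hinvc hinvp).HB →
          (ofConnectedTemperoidData h Q odd_l R ιX K' constEmb constEmb_injective hinvc hinvp).lDeltaModN
            (ofConnectedTemperoidData h Q odd_l R ιX K' constEmb constEmb_injective hinvc hinvp).BN,
        FrobenioidThetaBiKummer.ThetaPairKummerClass
          (ofConnectedTemperoidData h Q odd_l R ιX K' constEmb constEmb_injective hinvc hinvp) η ν :=
  ⟨strvSection_ofConnectedTemperoidData h Q odd_l R ιX K' constEmb constEmb_injective hinvc hinvp,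
    exists_thetaPairKummerClass_ofConnectedTemperoidData h Q odd_l R ιX K' constEmb constEmb_injective hinvc hinvp hH hconst
      hgc⟩

end ConnectedTemperoid

end ThetaFrobenioid

end Literature.AnabelianGeometry.EtaleTheta

end
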